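import Summits.Ventures.LatticeQCDFlow.Scaling.BooleanStarOneCopyDrift

/-!
HONEST FRAMING: exact (Metropolis-corrected) sampling algorithms for lattice gauge theory; figures
of merit are autocorrelation/cost numbers at stated couplings and volumes; no continuum-physics
claim.

# BooleanStarCleanColdLaw — THE ONE-DIMENSIONAL ROUTE AT WORK: IN THE CLEAN-COLD CORNER (`rr(K+1) ≤ 1/4`, `μ_1(b̄)K ≤ μ_1(b)/8`) THE HOMOGENEOUS BOOLEAN STAR
# MIXES IN `O((K/(μ_0(b)·min{t,h}))·log(K/ε))` FOR ALL `K` AND ALL `t/h` — THE CONJECTURED ORDER WHERE THE PLAIN COUNT LOSES `h/t` (lean-2 GEN-32, ours)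

Venture-side (OURS).  Cell `lqcd-flow` (pub-lqcd), unit `pub-lqcd-lean-2-g32`, 2026-08-29.  Chapter S, file 10, on top of `BooleanStarOneCopyDrift` (S9).
S9 reduced OPEN-MATH item 1 (ii) for the homogeneous Boolean star (all `K`) to a drift inequality for a function `φ` of ONE copy's cold `b̄`-count `B ∈ {0,…,K}`, a
birth–death quantity with down-probability `μ_0(b)π_b(B)` and up-probability `μ_0(b̄)π_b̄(B)` per redraw cycle.  S8 (plain count, `φ ≡ 0`) is sharp except in the
strong-drift, fast-swap corner `rr ≪ μ_0(b)`, `t ≫ h`, where the coupling bracket `μ_0(b)[π_b(B₂) − π_b(B₁)]` degenerates because `π_b` saturates at large `B`.  THIS FILE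
settles the sub-corner in which the cold law is CLEAN — fewer than one disliked cold level at equilibrium: `μ_0(b̄)·rr·K ≤ μ_0(b)/8`, i.e. `μ_1(b̄)·K ≤ μ_1(b)/8`, together
with `rr(K+1) ≤ 1/4` — by the simplest drifting potential `φ(B) = max{B, 0}` (the count itself, slope one, no interior kink): its one-cycle drift gain
`μ_0(b)π_b(B) − μ_0(b̄)π_b̄(B)` is a full down-step minus an up-step, the up-steps are uniformly small (`π_b̄ ≤ rr·t/(h+c)`, so `μ_0(b̄)π_b̄ ≤ μ_0(b)c/(8(h+c))`) while a
down-step from `B₂ ≥ 1` is large (`π_b(B₂) ≥ (4/5)c/(h+c)` and `≥ cB₂/(h+2t)`), leaving `(11/16)μ_0(b)π_b(B₂) ≥ 2ρB₂ = ρ(B₂ − B₁ + φ(B₁) + φ(B₂))` with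
`ρ = (11/32)μ_0(b)c/(h+2t)`.  Hence the law with `hρ ≍ μ_0(b)·min{t,h}/K`, the conjectured order, uniformly in `t/h` — where S8 gives only `hρ ≍ (c/t)(p·h²/t + rr·h)`.

What remains of item 1 (ii) on the homogeneous Boolean star after S8 + S10: the corner `t ≫ h`, `rr ≪ μ_0(b)` with a MACROSCOPIC equilibrium bad pool
(`μ_0(b̄)·rr·K ≳ μ_0(b)`), where `φ` must be flat at the equilibrium count `B* ≍ rr·K·μ_0(b̄)/μ_0(b)` and rise on both sides (the Huber design of the memo, §9/§17) — a
statement about the same birth–death chain, to be proved through `boolStar_mixingTime_le_of_oneCopyDrift`.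

## What is proved

* **`oneCopyDrift_cleanCold`** — the drift inequality of S9 for `φ = max{·,0}`, `ρ = (11/32)μ_0(b)c/(h+2t)`, under `rr(K+1) ≤ 1/4`, `μ_0(b̄)·rr·K ≤ μ_0(b)/8`
  (pure real arithmetic on the explicit `π_b`, `π_b̄`).
* **`boolStar_mixingTime_le_cleanCold`** — homogeneous Boolean star, `m ≥ 1` uniform entries, `0 < t < 1`, `w_0 > 0`, positive laws, idle cold levels, liked content `b`,
  `μ_0(b)μ_1(b̄)(K+1) ≤ μ_0(b̄)μ_1(b)/4`, `μ_1(b̄)K ≤ μ_1(b)/8` ⇒ `t_mix(ε) ≤ ⌈(4/(hρ))·log((3eK+1)/ε)⌉₊`, `ρ = (11/32)μ_0(b)(t/K)/(h+2t)`.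

NOT CLAIMED: the macroscopic-pool corner; anything measured; optimal constants.  Literature grade (cell rule): OWN, elementary; nothing cited as a fact; no new bib keys.
-/

noncomputable section

namespace Summit.Ventures.LatticeQCDFlow.Scaling

/-! ## §1 The one-dimensional drift inequality in the clean-cold corner, with `φ(x) = max{x, 0}` -/

section Law
open Finset Function Matrix
open Literature.Probability.MarkovChains

variable {K m : ℕ} {μ : Fin (K + 1) → Bool → ℝ} {M : Fin (K + 1) → Bool → Bool → ℝ} {w : Fin (K + 1) → ℝ} {t : ℝ}
variable (κ : Fin m → Fin K)

omit κ in
/-- **THE DRIFT INEQUALITY IN THE CLEAN-COLD CORNER.**  With `φ(x) = max{x, 0}` (the cold `b̄`-count itself), `h > 0`, `0 < c ≤ t` (`t = cK`), `0 ≤ rr`,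
`rr(K+1) ≤ 1/4` and `μ_0(b̄)·rr·K ≤ μ_0(b)/8` (the equilibrium cold `b̄`-count is below one level), for all naturals `B₁ < B₂ ≤ K`:
`ρ(B₂ − B₁ + φ(B₁) + φ(B₂)) ≤ μ_0(b)[π_b(B₂) − π_b(B₁)] + μ_0(b̄)[π_b̄(B₁) − π_b̄(B₂)] + d(B₁) + d(B₂)` with **`ρ = (11/32)·μ_0(b)·c/(h + 2t)`**: the down-steps
`μ_0(b)π_b(B₂) ≥ (4/5)μ_0(b)c/(h+c)` pay for both up-steps (`≤ μ_0(b̄)·rr·t/(h+c)` each) and leave `(11/16)μ_0(b)π_b(B₂) ≥ 2ρB₂`. [ours] -/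
theorem oneCopyDrift_cleanCold {h c t rr K μb μb' ρ : ℝ} {πb πb' φ : ℝ → ℝ} (hh : 0 < h) (hc : 0 < c) (hct : c ≤ t) (htK : t = c * K)
    (hrr0 : 0 ≤ rr) (hK4 : rr * (K + 1) ≤ 1 / 4) (hμb : 0 ≤ μb) (hμb' : 0 ≤ μb') (hB : μb' * rr * K ≤ μb / 8)
    (hπb : ∀ B, πb B = c * B / (h + c * B + c * rr * (K - B + 1)))
    (hπb' : ∀ B, πb' B = c * (K - B) * rr / (h + c * (K - B) * rr + c * (B + 1)))
    (hφ : ∀ x, φ x = max x 0) (hρ : ρ = 11 / 32 * μb * c / (h + 2 * t))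
    (B₁ B₂ : ℕ) (h12 : B₁ + 1 ≤ B₂) (h2K : (B₂ : ℝ) ≤ K) :
    ρ * ((B₂ : ℝ) - B₁ + φ B₁ + φ B₂) ≤ μb * (πb B₂ - πb B₁) + μb' * (πb' B₁ - πb' B₂)
        + (μb * πb B₁ * (φ B₁ - φ (B₁ - 1)) - μb' * πb' B₁ * (φ (B₁ + 1) - φ B₁))
        + (μb * πb B₂ * (φ B₂ - φ (B₂ - 1)) - μb' * πb' B₂ * (φ (B₂ + 1) - φ B₂)) := by
  have hB1 : (B₁ : ℝ) + 1 ≤ B₂ := by exact_mod_cast h12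
  have hB10 : (0 : ℝ) ≤ B₁ := Nat.cast_nonneg _
  have hB21 : (1 : ℝ) ≤ B₂ := by linarith
  have ht0 : 0 < t := lt_of_lt_of_le hc hct
  have hK1 : (B₁ : ℝ) + 1 ≤ K := by linarith
  -- values of `φ`
  have f2 : φ B₂ = B₂ := by rw [hφ]; exact max_eq_left (by linarith)
  have f2m : φ ((B₂ : ℝ) - 1) = B₂ - 1 := by rw [hφ]; exact max_eq_left (by linarith)
  have f2p : φ ((B₂ : ℝ) + 1) = B₂ + 1 := by rw [hφ]; exact max_eq_left (by linarith)
  have f1 : φ B₁ = B₁ := by rw [hφ]; exact max_eq_left hB10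
  have f1p : φ ((B₁ : ℝ) + 1) = B₁ + 1 := by rw [hφ]; exact max_eq_left (by linarith)
  have f1m : 0 ≤ φ B₁ - φ ((B₁ : ℝ) - 1) := by
    rw [hφ, hφ, max_eq_left hB10]
    rcases le_or_gt 0 ((B₁ : ℝ) - 1) with h0 | h0
    · rw [max_eq_left h0]; linarith
    · rw [max_eq_right h0.le]; linarith
  -- denominators
  have dB : ∀ B : ℝ, 0 ≤ B → B ≤ K → 0 < h + c * B + c * rr * (K - B + 1) := fun B hB0 hBK => by
    have : 0 ≤ c * rr * (K - B + 1) := mul_nonneg (mul_nonneg hc.le hrr0) (by linarith)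
    have : 0 ≤ c * B := by positivity
    linarith
  have dB' : ∀ B : ℝ, 0 ≤ B → B ≤ K → h + c ≤ h + c * (K - B) * rr + c * (B + 1) := fun B hB0 hBK => by
    have : 0 ≤ c * (K - B) * rr := mul_nonneg (mul_nonneg hc.le (by linarith)) hrr0
    nlinarith
  have hc' : 0 < h + c := by linarith
  -- `π_b ≥ 0`, `π_b̄ ≥ 0`, `π_b̄ ≤ rr·t/(h+c)`
  have pb1 : 0 ≤ πb B₁ := by rw [hπb]; exact div_nonneg (by positivity) (dB _ hB10 (by linarith)).le
  have pb'le : ∀ B : ℝ, 0 ≤ B → B ≤ K → 0 ≤ πb' B ∧ πb' B ≤ rr * t / (h + c) := fun B hB0 hBK => by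
    have hd := dB' B hB0 hBK
    have hd0 : 0 < h + c * (K - B) * rr + c * (B + 1) := lt_of_lt_of_le hc' hd
    have hn : 0 ≤ c * (K - B) * rr := mul_nonneg (mul_nonneg hc.le (by linarith)) hrr0
    rw [hπb']
    refine ⟨div_nonneg hn hd0.le, ?_⟩
    rw [div_le_div_iff₀ hd0 hc']
    have e1 : c * (K - B) * rr ≤ rr * t := by rw [htK]; nlinarith [mul_nonneg hc.le hrr0]
    calc c * (K - B) * rr * (h + c) ≤ rr * t * (h + c) := mul_le_mul_of_nonneg_right e1 hc'.le
      _ ≤ rr * t * (h + c * (K - B) * rr + c * (B + 1)) := mul_le_mul_of_nonneg_left hd (by positivity)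
  obtain ⟨pb'1, pb'1le⟩ := pb'le B₁ hB10 (by linarith)
  obtain ⟨pb'2, pb'2le⟩ := pb'le B₂ (by linarith) h2K
  -- `π_b(B₂) ≥ cB₂/(h + 2t)` and `π_b(B₂) ≥ (4/5)·c/(h + c)`
  have hd2 := dB B₂ (by linarith) h2K
  have hden2 : h + c * B₂ + c * rr * (K - B₂ + 1) ≤ h + c * B₂ + c / 4 := by
    have : c * rr * (K - B₂ + 1) ≤ c * (rr * (K + 1)) := by nlinarith [mul_nonneg hc.le hrr0]
    have : c * (rr * (K + 1)) ≤ c * (1 / 4) := mul_le_mul_of_nonneg_left hK4 hc.le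
    linarith
  have pb2a : c * B₂ / (h + 2 * t) ≤ πb B₂ := by
    rw [hπb]
    apply div_le_div_of_nonneg_left (by positivity) hd2
    have : c * (B₂ : ℝ) ≤ t := by rw [htK]; exact mul_le_mul_of_nonneg_left h2K hc.le
    linarith
  have pb2b : 4 / 5 * (c / (h + c)) ≤ πb B₂ := by
    rw [hπb, div_mul_div_comm]
    rw [div_le_div_iff₀ (by positivity) hd2]
    have e : c * B₂ * (5 * (h + c)) - 4 * c * (h + c * B₂ + c / 4) = c * h * (5 * B₂ - 4) + c * c * (B₂ - 1) := by ring
    have p1 : 0 ≤ c * h * (5 * B₂ - 4) := mul_nonneg (mul_nonneg hc.le hh.le) (by linarith)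
    have p2 : 0 ≤ c * c * (B₂ - 1) := mul_nonneg (mul_nonneg hc.le hc.le) (by linarith)
    have p3 := mul_le_mul_of_nonneg_left hden2 (show (0 : ℝ) ≤ 4 * c by positivity)
    linarith
  have pb2 : 0 ≤ πb B₂ := le_trans (by positivity) pb2a
  -- the up-steps are paid by a quarter of a down-step: `μb'·π_b̄ ≤ μb·c/(8(h+c)) ≤ (5/32)·μb·π_b(B₂)`
  have up : μb' * πb' B₁ + μb' * πb' B₂ ≤ 5 / 16 * (μb * πb B₂) := by
    have u1 : μb' * πb' B₁ ≤ μb' * (rr * t / (h + c)) := mul_le_mul_of_nonneg_left pb'1le hμb'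
    have u2 : μb' * πb' B₂ ≤ μb' * (rr * t / (h + c)) := mul_le_mul_of_nonneg_left pb'2le hμb'
    have u3 : μb' * (rr * t / (h + c)) ≤ μb / 8 * (c / (h + c)) := by
      rw [htK, show μb' * (rr * (c * K) / (h + c)) = μb' * rr * K * (c / (h + c)) by ring]
      exact mul_le_mul_of_nonneg_right hB (by positivity)
    have u4 : μb / 8 * (c / (h + c)) ≤ 5 / 32 * (μb * πb B₂) := by
      have := mul_le_mul_of_nonneg_left pb2b hμb
      linarith
    linarith
  -- monotone differences are `≥ 0`: `π_b(B₂) − π_b(B₁) ≥ 0`, `π_b̄(B₁) − π_b̄(B₂) ≥ 0`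
  have mono1 : 0 ≤ πb B₂ - πb B₁ := by
    have hd1 := dB B₁ hB10 (by linarith)
    rw [hπb, hπb, div_sub_div _ _ hd2.ne' hd1.ne']
    apply div_nonneg _ (by positivity)
    have : c * ↑B₂ * (h + c * ↑B₁ + c * rr * (↑K - ↑B₁ + 1)) - (h + c * ↑B₂ + c * rr * (↑K - ↑B₂ + 1)) * (c * ↑B₁)
        = c * (B₂ - B₁) * (h + c * rr * (K + 1)) := by ring
    rw [this]
    have q1 : 0 ≤ c * rr * (K + 1) := mul_nonneg (mul_nonneg hc.le hrr0) (by linarith)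
    have q2 : (0 : ℝ) ≤ B₂ - B₁ := by linarith
    exact mul_nonneg (mul_nonneg hc.le q2) (by linarith)
  have mono2 : 0 ≤ πb' B₁ - πb' B₂ := by
    have hd1 : 0 < h + c * (K - B₁) * rr + c * (B₁ + 1) := lt_of_lt_of_le hc' (dB' B₁ hB10 (by linarith))
    have hd2' : 0 < h + c * (K - B₂) * rr + c * (B₂ + 1) := lt_of_lt_of_le hc' (dB' B₂ (by linarith) h2K)
    rw [hπb', hπb', div_sub_div _ _ hd1.ne' hd2'.ne']
    apply div_nonneg _ (by positivity)
    have : c * (↑K - ↑B₁) * rr * (h + c * (↑K - ↑B₂) * rr + c * (↑B₂ + 1)) - (h + c * (↑K - ↑B₁) * rr + c * (↑B₁ + 1)) * (c * (↑K - ↑B₂) * rr)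
        = c * rr * (B₂ - B₁) * (h + c * (K + 1)) := by ring
    rw [this]
    have q2 : (0 : ℝ) ≤ B₂ - B₁ := by linarith
    have q3 : (0 : ℝ) ≤ c * (K + 1) := mul_nonneg hc.le (by linarith)
    exact mul_nonneg (mul_nonneg (mul_nonneg hc.le hrr0) q2) (by linarith)
  -- assemble
  rw [f1, f2, f2m, f2p, f1p, show (B₂ : ℝ) - B₁ + B₁ + B₂ = 2 * B₂ by ring, show (B₂ : ℝ) - (B₂ - 1) = 1 by ring,
    show (B₂ : ℝ) + 1 - B₂ = 1 by ring, show (B₁ : ℝ) + 1 - B₁ = 1 by ring, mul_one, mul_one, mul_one]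
  have g1 : 0 ≤ μb * (πb B₂ - πb B₁) := mul_nonneg hμb mono1
  have g2 : 0 ≤ μb' * (πb' B₁ - πb' B₂) := mul_nonneg hμb' mono2
  rw [f1] at f1m
  have g3 : 0 ≤ μb * πb B₁ * ((B₁ : ℝ) - φ (B₁ - 1)) := mul_nonneg (mul_nonneg hμb pb1) f1m
  have main : ρ * (2 * B₂) ≤ 11 / 16 * (μb * πb B₂) := by
    rw [hρ]
    have := mul_le_mul_of_nonneg_left pb2a hμb
    have hS : 0 < h + 2 * t := by linarith
    have e : 11 / 32 * μb * c / (h + 2 * t) * (2 * B₂) = 11 / 16 * (μb * (c * B₂ / (h + 2 * t))) := by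
      field_simp; ring
    rw [e]; linarith
  linarith [up, g1, g2, g3, main]

/-- **THE COLD-START LAW IN THE CLEAN-COLD CORNER, ALL `K`, OPTIMAL ORDER IN EVERY `t/h` REGIME.**  Homogeneous Boolean star (`m ≥ 1` uniform entries, `0 < t < 1`,
`w_0 > 0`, positive laws, idle cold levels, exact hot redraws), liked content `b`, `rr = μ_0(b)μ_1(b̄)/(μ_0(b̄)μ_1(b))`, `h = (1−t)w_0`.  If the cold law is clean —
`μ_0(b)μ_1(b̄)(K+1) ≤ μ_0(b̄)μ_1(b)/4` (`rr(K+1) ≤ 1/4`) and `μ_1(b̄)·K ≤ μ_1(b)/8` (`μ_0(b̄)·rr·K ≤ μ_0(b)/8`: fewer than one disliked cold level at equilibrium) — then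
**`t_mix(ε) ≤ ⌈(4/(hρ))·log((3eK+1)/ε)⌉₊`, `ρ = (11/32)·μ_0(b)·(t/K)/(h + 2t)`**, i.e. `O((K/(μ_0(b)·min{t, h}))·log(K/ε))` — the conjectured law-free order of OPEN-MATH
item 1 (ii) up to an absolute constant, in the strong-drift corner `rr ≪ μ_0(b)` where the plain count (S8) loses `h/t`; via S9 with `φ(x) = max{x,0}`. [ours] -/
theorem boolStar_mixingTime_le_cleanCold (hm : 1 ≤ m) (ht0 : 0 < t) (ht1 : t < 1) (hw0 : ∀ k, 0 ≤ w k) (hw00 : 0 < w 0)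
    (hw1 : ∑ k, w k = 1) (hμ : ∀ k x, 0 < μ k x) (hμ1 : ∀ k, ∑ u, μ k u = 1) (hM0 : ∀ u v, M 0 u v = μ 0 v)
    (hidle : ∀ i : Fin K, ∀ u v, M i.succ u v = if v = u then 1 else 0) (hhom : ∀ i : Fin K, μ i.succ = μ 1)
    {c0 : ℕ} (hunif : ∀ i : Fin K, (univ.filter fun r : Fin m => κ r = i).card = c0)
    {b : Bool} (hb : μ 0 b * μ 1 (!b) ≤ μ 0 (!b) * μ 1 b)
    (hK4 : μ 0 b * μ 1 (!b) * (K + 1) ≤ μ 0 (!b) * μ 1 b / 4) (hclean : μ 1 (!b) * K ≤ μ 1 b / 8)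
    {ε : ℝ} (hε : 0 < ε) :
    mixingTime (fun y z : Fin (K + 1) → Bool =>
        t * ptGraphSwap μ (fun r : Fin m => (((0 : Fin (K + 1)), (κ r).succ) : Fin (K + 1) × Fin (K + 1))) (fun _ : Fin m => Equiv.refl Bool) y z
          + (1 - t) * prodKernel w M y z) (tensorFun μ) ε
      ≤ ⌈1 / ((1 - t) * w 0 * (11 / 32 * μ 0 b * (t / K) / ((1 - t) * w 0 + 2 * t)) / 4) * Real.log ((Real.exp 1 * (K + 2 * K) + 1) / ε)⌉₊ := by
  let rr : ℝ := μ 0 b * μ 1 (!b) / (μ 0 (!b) * μ 1 b)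
  let φ : ℝ → ℝ := fun x => max x 0
  let πb : ℝ → ℝ := fun B => t / K * B / ((1 - t) * w 0 + t / K * B + t / K * rr * (K - B + 1))
  let πb' : ℝ → ℝ := fun B => t / K * (K - B) * rr / ((1 - t) * w 0 + t / K * (K - B) * rr + t / K * (B + 1))
  have hmK : (m : ℝ) = c0 * K := uniformList_card κ hunif
  have hK1 : (1 : ℝ) ≤ K := by
    have hK0 : K ≠ 0 := by
      intro h0; have : (m : ℝ) = 0 := by rw [hmK, h0]; simp
      exact absurd (by exact_mod_cast this : m = 0) (by omega)
    exact_mod_cast Nat.one_le_iff_ne_zero.mpr hK0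
  obtain ⟨-, hrr0, -⟩ := boolStar_acc_disliked (acc := fun u v => min 1 (μ 0 v * μ 1 u / (μ 0 u * μ 1 v))) hμ (fun u v => rfl) hb (rr := rr) rfl
  have hh0 : 0 < (1 - t) * w 0 := mul_pos (by linarith) hw00
  have hc0 : 0 < t / K := div_pos ht0 (by linarith)
  have hct : t / K ≤ t := div_le_self ht0.le hK1
  have htK : t = t / K * K := by field_simp
  have hd0 : 0 < μ 0 (!b) * μ 1 b := mul_pos (hμ 0 (!b)) (hμ 1 b)
  have hK4' : rr * (K + 1) ≤ 1 / 4 := by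
    show μ 0 b * μ 1 (!b) / (μ 0 (!b) * μ 1 b) * (K + 1) ≤ 1 / 4
    rw [div_mul_eq_mul_div, div_le_iff₀ hd0]; linarith
  have hB : μ 0 (!b) * rr * K ≤ μ 0 b / 8 := by
    show μ 0 (!b) * (μ 0 b * μ 1 (!b) / (μ 0 (!b) * μ 1 b)) * K ≤ μ 0 b / 8
    have hne1 : μ 0 (!b) ≠ 0 := (hμ 0 (!b)).ne'
    have hne2 : μ 1 b ≠ 0 := (hμ 1 b).ne'
    have e : μ 0 (!b) * (μ 0 b * μ 1 (!b) / (μ 0 (!b) * μ 1 b)) * K = μ 0 b * (μ 1 (!b) * K) / μ 1 b := by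
      field_simp
    rw [e, div_le_iff₀ (hμ 1 b)]
    have := mul_le_mul_of_nonneg_left hclean (hμ 0 b).le
    linarith
  have hρ0 : 0 < 11 / 32 * μ 0 b * (t / K) / ((1 - t) * w 0 + 2 * t) := by have := hμ 0 b; positivity
  have hρ1 : 11 / 32 * μ 0 b * (t / K) / ((1 - t) * w 0 + 2 * t) ≤ 1 := by
    rw [div_le_one (by linarith)]
    have h1 : μ 0 b ≤ 1 := by
      have := hμ1 0; rw [Fintype.sum_bool] at this; have := hμ 0 true; have := hμ 0 false; cases b <;> simp <;> linarith
    have : 11 / 32 * μ 0 b * (t / K) ≤ 11 / 32 * 1 * t := by gcongr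
    linarith
  have hφ0 : ∀ x, 0 ≤ φ x := fun x => le_max_right _ _
  have hφ : ∀ x y, |φ x - φ y| ≤ |x - y| := fun x y => abs_max_sub_max_le_abs x y 0
  have hφm : ∀ n : ℕ, n ≤ K → φ n ≤ (K : ℝ) := fun n hn => by
    show max (n : ℝ) 0 ≤ K; rw [max_eq_left (Nat.cast_nonneg _)]; exact_mod_cast hn
  exact boolStar_mixingTime_le_of_oneCopyDrift κ hm ht0 ht1 hw0 hw00 hw1 hμ hμ1 hM0 hidle hhom hunif hb (rr := rr) rfl hφ0 hφ hφm
    (πb := πb) (πb' := πb') (fun B => rfl) (fun B => rfl) hρ0 hρ1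
    (fun B₁ B₂ h12 h2K => oneCopyDrift_cleanCold (φ := φ) hh0 hc0 hct htK hrr0 hK4' (hμ 0 b).le (hμ 0 (!b)).le hB
      (fun B => rfl) (fun B => rfl) (fun x => rfl) rfl B₁ B₂ h12 (by exact_mod_cast h2K)) hε

end Law

end Summit.Ventures.LatticeQCDFlow.Scaling

end
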